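import Summits.ValiantsHypothesis.ValiantsHypothesis.Theorems.BarrierLeverAnchoredDoorHitsLowerPairsUQ2FaceStep
import Summits.ValiantsHypothesis.ValiantsHypothesis.Theorems.BarrierLeverAnchoredDoorHitsLowerPairsGraphPairs

/-!
# Support item `AnchoredDoorHitsLowerPairs` (stmt-ValiantsHypothesis-22510), line `anchored-peeling`:
# THE UQ² RESIDUAL — kernel induction and composition by name

Prover file (`--supports stmt-ValiantsHypothesis-22510`; cell valiant-natproofs, rung V4, 𝒟-side door (c); registered line
`Cruxes/AnchoredDoorHitsLowerPairs/Lines/anchored_peeling.lean` v14/v15; prover seat val-np-p1 gen 20). Closes NO item.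

With the UQ² face step a kernel theorem (`stub_uq2FaceStep`, file `…UQ2FaceStep`), strong induction on `r` (base `stub_base`; x-side step; y-side step via
`symbolicDet_ne_zero_comm`; otherwise the residual) gives `Stmt.stub_uq2FaceResidual → Stmt.stub_symbolicNonvanishing` and hence the support item BY NAME
(`anchoredDoorHitsLowerPairs_of_uq2FaceResidual`, through `stub_genericPoint`); and the registered residual implies the UQ² residual
(`exists_uqf2Data_of_uqfData`: face-UQ data are UQ² data with the largest faces through `W₀` as targets; `stub_uq2FaceResidual_of_uqFaceResidual`). The bookkeeping lemmas (`UQInduction.*`: the two sub-pairs are shorter and lower)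
are the ones of `…UQFaceStep` (p614490), restated because they are private there.

WHAT THIS IS NOT: the UQ² residual is OPEN (census-empty; first theoretical members cube_{2k}/B(2k+1,k)-type with k ≳ 7 at s = 2 and the deep-vs-very-wide
pairs); nothing on crux stmt-ValiantsHypothesis-14610 or on `VP` versus `VNP`.
-/

set_option linter.dupNamespace false

namespace Summit.ValiantsHypothesis.ValiantsHypothesis.Theorems.BarrierLever.AnchoredPeeling

open Finset MvPolynomial

noncomputable section

variable {h : ℕ}

/-! ## Bookkeeping (from `…UQFaceStep`, where these are private) -/

section Bookkeeping

variable {r : ℕ}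

/-- An injective family whose range is a subset of `range u` missing the face `u i₀` is strictly shorter. -/
theorem UQInduction.lt_of_range_subset_missing {r₀ : ℕ} {u : Fin r → Finset (Fin h)} {u₀ : Fin r₀ → Finset (Fin h)}
    (hu : Function.Injective u) (hu₀ : Function.Injective u₀) (hsub : Set.range u₀ ⊆ Set.range u)
    (i₀ : Fin r) (hmiss : u i₀ ∉ Set.range u₀) : r₀ < r := by
  classical
  have hss : Finset.univ.image u₀ ⊂ Finset.univ.image u := by
    rw [Finset.ssubset_iff_subset_ne]
    refine ⟨?_, ?_⟩
    · intro x hx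
      rw [Finset.mem_image] at hx ⊢
      obtain ⟨i, _, rfl⟩ := hx
      obtain ⟨j, hj⟩ := hsub ⟨i, rfl⟩
      exact ⟨j, Finset.mem_univ _, hj⟩
    · intro heq
      have : u i₀ ∈ Finset.univ.image u₀ := by rw [heq]; exact Finset.mem_image.mpr ⟨i₀, Finset.mem_univ _, rfl⟩
      obtain ⟨i, _, hi⟩ := Finset.mem_image.mp this
      exact hmiss ⟨i, hi⟩
  have := Finset.card_lt_card hss
  rwa [ThinStep.card_image_univ_of_injective hu₀, ThinStep.card_image_univ_of_injective hu] at this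

/-- The deletion-minus-up-set family is shorter than `u` (it misses a face containing `a`). -/
theorem UQInduction.lt_of_deletion {r₀ : ℕ} {u : Fin r → Finset (Fin h)} {u₀ : Fin r₀ → Finset (Fin h)} {a : Fin h}
    {𝒜 : Finset (Finset (Fin h))} (hu : Function.Injective u) (hu₀ : Function.Injective u₀) (ha : ∃ i, a ∈ u i)
    (hr₀ : Set.range u₀ = {S | S ∈ Set.range u ∧ a ∉ S ∧ S ∉ 𝒜}) : r₀ < r := by
  obtain ⟨i₀, hi₀⟩ := ha
  refine UQInduction.lt_of_range_subset_missing hu hu₀ (fun S hS => by rw [hr₀] at hS; exact hS.1) i₀ ?_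
  intro hmem
  rw [hr₀] at hmem
  exact hmem.2.1 hi₀

/-- The link family is shorter than `u` (its `insert a`-image misses `∅`). -/
theorem UQInduction.lt_of_link {r₁ : ℕ} {u : Fin r → Finset (Fin h)} {u₁ : Fin r₁ → Finset (Fin h)} {a : Fin h}
    (hu : Function.Injective u) (hu₁ : Function.Injective u₁) (hlu : IsLowerSet (Set.range u)) (ha : ∃ i, a ∈ u i)
    (hr₁ : Set.range u₁ = {S | a ∉ S ∧ insert a S ∈ Set.range u}) : r₁ < r := by
  classical
  have hmem : ∀ i, a ∉ u₁ i ∧ insert a (u₁ i) ∈ Set.range u := fun i => by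
    have hi : u₁ i ∈ Set.range u₁ := ⟨i, rfl⟩
    rw [hr₁] at hi
    exact hi
  let g : Fin r₁ → Finset (Fin h) := fun i => insert a (u₁ i)
  have hg : Function.Injective g := by
    intro i j hij
    apply hu₁
    have h1 : (insert a (u₁ i)).erase a = u₁ i := Finset.erase_insert (hmem i).1
    have h2 : (insert a (u₁ j)).erase a = u₁ j := Finset.erase_insert (hmem j).1
    rw [← h1, ← h2]
    exact congrArg (fun S => Finset.erase S a) hij
  obtain ⟨i₀, hi₀⟩ := ha
  have hempty : (∅ : Finset (Fin h)) ∈ Set.range u := hlu (Finset.empty_subset (u i₀)) ⟨i₀, rfl⟩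
  obtain ⟨j₀, hj₀⟩ := hempty
  refine UQInduction.lt_of_range_subset_missing hu hg ?_ j₀ ?_
  · rintro S ⟨i, rfl⟩
    exact (hmem i).2
  · rintro ⟨i, hi⟩
    have : a ∈ (∅ : Finset (Fin h)) := by rw [← hj₀, ← hi]; exact Finset.mem_insert_self _ _
    exact Finset.notMem_empty _ this

/-- The deletion complex minus an up-set is a lower family. -/
theorem UQInduction.lowerSet_deletion {r₀ : ℕ} {u : Fin r → Finset (Fin h)} {u₀ : Fin r₀ → Finset (Fin h)} {a : Fin h}
    {𝒜 : Finset (Finset (Fin h))} (hlu : IsLowerSet (Set.range u)) (hup : ∀ A ∈ 𝒜, ∀ i, A ⊆ u i → a ∉ u i → u i ∈ 𝒜)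
    (hr₀ : Set.range u₀ = {S | S ∈ Set.range u ∧ a ∉ S ∧ S ∉ 𝒜}) : IsLowerSet (Set.range u₀) := by
  rw [hr₀]
  intro S T hTS hS
  obtain ⟨⟨i, hi⟩, haS, hS𝒜⟩ := hS
  refine ⟨hlu hTS ⟨i, hi⟩, fun haT => haS (hTS haT), fun hT𝒜 => hS𝒜 ?_⟩
  have := hup T hT𝒜 i (hi ▸ hTS) (hi ▸ haS)
  rwa [hi] at this

/-- Removing the (up-closed) star of a face from a lower family leaves a lower family. -/
theorem UQInduction.lowerSet_colStarDeletion {r₀ : ℕ} {w : Fin r → Finset (Fin h)} {w₀ : Fin r₀ → Finset (Fin h)} {W₀ : Finset (Fin h)}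
    (hlw : IsLowerSet (Set.range w)) (hr₀ : Set.range w₀ = {T | T ∈ Set.range w ∧ ¬ W₀ ⊆ T}) : IsLowerSet (Set.range w₀) := by
  rw [hr₀]
  intro S T hTS hS
  exact ⟨hlw hTS hS.1, fun hT => hS.2 (hT.trans hTS)⟩

/-- The link of a vertex is a lower family. -/
theorem UQInduction.lowerSet_link {r₁ : ℕ} {u : Fin r → Finset (Fin h)} {u₁ : Fin r₁ → Finset (Fin h)} {a : Fin h}
    (hlu : IsLowerSet (Set.range u)) (hr₁ : Set.range u₁ = {S | a ∉ S ∧ insert a S ∈ Set.range u}) :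
    IsLowerSet (Set.range u₁) := by
  rw [hr₁]
  intro S T hTS hS
  exact ⟨fun haT => hS.1 (hTS haT), hlu (Finset.insert_subset_insert a hTS) hS.2⟩

end Bookkeeping

/-! ## The residual and the induction -/

/-- Unpacking the pieces of `UQF2Data` that the induction needs. -/
private theorem uqf2Data_basic {s r : ℕ} {u w : Fin r → Finset (Fin h)} {a : Fin h} {W₀ : Finset (Fin h)} {𝒜 : Finset (Finset (Fin h))}
    {ρ β σ : Finset (Fin h) → Finset (Fin h)} (hD : UQF2Data s u w a W₀ 𝒜 ρ β σ) :
    (∃ i, a ∈ u i) ∧ (∀ A ∈ 𝒜, ∀ i, A ⊆ u i → a ∉ u i → u i ∈ 𝒜) := ⟨hD.1, hD.2.2.2.2.2.1⟩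

/-- **THE INDUCTION (kernel-checked): UQ² face step (proved) ∧ UQ²-residual ⟹ the line's symbolic non-vanishing stub.** -/
theorem stub_symbolicNonvanishing_of_uq2Face (hres : Stmt.stub_uq2FaceResidual) : Stmt.stub_symbolicNonvanishing := by
  obtain ⟨s, h₀, hs, hR⟩ := hres
  refine ⟨s, h₀, fun h hh => ?_⟩
  intro r
  induction r using Nat.strong_induction_on with
  | _ r ih =>
    intro u w hu hw hlu hlw
    by_cases hr : r ≤ 1
    · exact stub_base s h r u w hu hw hlu hlw hr
    · have hr2 : 2 ≤ r := by omega
      by_cases hx : ∃ (a : Fin h) (W₀ : Finset (Fin h)) (𝒜 : Finset (Finset (Fin h))) (ρ β σ : Finset (Fin h) → Finset (Fin h)),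
          UQF2Data s u w a W₀ 𝒜 ρ β σ
      · obtain ⟨a, W₀, 𝒜, ρ, β, σ, hD⟩ := hx
        obtain ⟨ha, hup⟩ := uqf2Data_basic hD
        refine stub_uq2FaceStep s h r u w hs hu hw hlu hlw a W₀ 𝒜 ρ β σ hD ?_ ?_
        · intro r₀ u₀ w₀ hu₀ hw₀ hru₀ hrw₀
          exact ih r₀ (UQInduction.lt_of_deletion hu hu₀ ha hru₀) u₀ w₀ hu₀ hw₀ (UQInduction.lowerSet_deletion hlu hup hru₀)
            (UQInduction.lowerSet_colStarDeletion hlw hrw₀)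
        · intro r₁ u₁ w₁ hu₁ hw₁ hru₁ _ hlw₁
          exact ih r₁ (UQInduction.lt_of_link hu hu₁ hlu ha hru₁) u₁ w₁ hu₁ hw₁ (UQInduction.lowerSet_link hlu hru₁) hlw₁
      · by_cases hy : ∃ (c : Fin h) (Z : Finset (Fin h)) (𝒜 : Finset (Finset (Fin h))) (ρ β σ : Finset (Fin h) → Finset (Fin h)),
            UQF2Data s w u c Z 𝒜 ρ β σ
        · obtain ⟨c, Z, 𝒜, ρ, β, σ, hD⟩ := hy
          obtain ⟨hc, hup⟩ := uqf2Data_basic hD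
          refine (symbolicDet_ne_zero_comm s h r u w).mpr (stub_uq2FaceStep s h r w u hs hw hu hlw hlu c Z 𝒜 ρ β σ hD ?_ ?_)
          · intro r₀ u₀ w₀ hu₀ hw₀ hru₀ hrw₀
            exact ih r₀ (UQInduction.lt_of_deletion hw hu₀ hc hru₀) u₀ w₀ hu₀ hw₀ (UQInduction.lowerSet_deletion hlw hup hru₀)
              (UQInduction.lowerSet_colStarDeletion hlu hrw₀)
          · intro r₁ u₁ w₁ hu₁ hw₁ hru₁ _ hlw₁
            exact ih r₁ (UQInduction.lt_of_link hw hu₁ hlw hc hru₁) u₁ w₁ hu₁ hw₁ (UQInduction.lowerSet_link hlw hru₁) hlw₁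
        · push Not at hx hy
          exact hR h hh r u w hu hw hlu hlw hr2 (fun a W₀ 𝒜 ρ β σ => hx a W₀ 𝒜 ρ β σ) (fun c Z 𝒜 ρ β σ => hy c Z 𝒜 ρ β σ)

/-- **Composition BY NAME: the UQ²-residual ALONE implies the support item `AnchoredDoorHitsLowerPairs`** (route decl). -/
theorem anchoredDoorHitsLowerPairs_of_uq2FaceResidual (hres : Stmt.stub_uq2FaceResidual) :
    Summit.ValiantsHypothesis.ValiantsHypothesis.Theses.BarrierLever.AnchoredDoorHitsLowerPairs := by
  obtain ⟨s, h₀, H⟩ := stub_symbolicNonvanishing_of_uq2Face hres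
  exact ⟨s, h₀, fun h hh r u w hu hw hlu hlw => stub_genericPoint s h r u w (H h hh r u w hu hw hlu hlw)⟩

/-! ## The registered residual implies the UQ² residual (face-UQ data are UQ² data) -/

/-- **Face-UQ data give UQ² data**: take as target columns the `|𝒜|` LARGEST faces through `W₀` (their complement, the `ℓ_a` smallest ones, is then closed
under passing to smaller faces through `W₀`, i.e. the targets form an up-set of the star), any bijection `β` onto them, and `σ A = W₀`. -/
theorem exists_uqf2Data_of_uqfData {s r : ℕ} {u w : Fin r → Finset (Fin h)} (hw : Function.Injective w)
    {a : Fin h} {W₀ : Finset (Fin h)} {𝒜 : Finset (Finset (Fin h))} {ρ : Finset (Fin h) → Finset (Fin h)} (hD : UQFData s u w a W₀ 𝒜 ρ) :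
    ∃ β σ : Finset (Fin h) → Finset (Fin h), UQF2Data s u w a W₀ 𝒜 ρ β σ := by
  classical
  obtain ⟨ha, hW₀, hW1, hWs, h𝒜, hup, hcard, hρ, hρinj⟩ := hD
  -- the W₀-columns and the ℓ_a smallest ones
  let Y := {j : Fin r // W₀ ⊆ w j}
  let ℓa : ℕ := (Finset.univ.filter (fun i => a ∈ u i)).card
  have hYcard : Fintype.card Y = ℓa + 𝒜.card := by
    show Fintype.card {j : Fin r // W₀ ⊆ w j} = _
    rw [Fintype.card_subtype, ← hcard]
  obtain ⟨J₀, -, hJ₀card, hJ₀min⟩ := exists_subset_card_eq_minimal (Finset.univ : Finset Y) (fun y => (w y.1).card) ℓa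
    (by rw [Finset.card_univ, hYcard]; omega)
  -- the targets: the other columns, in bijection with 𝒜
  let Tg := {y : Y // y ∉ J₀}
  have hTg : Fintype.card Tg = Fintype.card 𝒜 := by
    show Fintype.card {y : Y // ¬ (y ∈ J₀)} = _
    rw [Fintype.card_subtype_compl, Fintype.card_coe, hYcard, Fintype.card_coe, hJ₀card]
    omega
  let eT : 𝒜 ≃ Tg := Fintype.equivOfCardEq hTg.symm
  let β : Finset (Fin h) → Finset (Fin h) := fun A => if hA : A ∈ 𝒜 then w (eT ⟨A, hA⟩).1.1 else ∅
  have hβA : ∀ A (hA : A ∈ 𝒜), β A = w (eT ⟨A, hA⟩).1.1 := fun A hA => by simp only [β, dif_pos hA]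
  refine ⟨β, fun _ => W₀, ⟨ha, hW₀, hW1, hWs, h𝒜, hup, hcard, hρ, ?_, ?_, ?_, ?_, ?_⟩⟩
  · intro A hA
    rw [hβA A hA]
    exact ⟨⟨_, rfl⟩, (eT ⟨A, hA⟩).1.2⟩
  · intro A hA A' hA' hAA
    have h1 : β A = β A' := hAA
    rw [hβA A hA, hβA A' hA'] at h1
    have h2 : eT ⟨A, hA⟩ = eT ⟨A', hA'⟩ := Subtype.ext (Subtype.ext (hw h1))
    exact congrArg Subtype.val (eT.injective h2)
  · -- up-set: a column above a target is a target (minimality of the kept cardinalities)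
    intro A hA j hAj
    rw [hβA A hA] at hAj
    have hWj : W₀ ⊆ w j := (eT ⟨A, hA⟩).1.2.trans hAj
    let y : Y := ⟨j, hWj⟩
    have hy : y ∉ J₀ := by
      intro hyJ
      have hle := hJ₀min y hyJ (eT ⟨A, hA⟩).1 (Finset.mem_univ _) (eT ⟨A, hA⟩).2
      have heq : w (eT ⟨A, hA⟩).1.1 = w j := Finset.eq_of_subset_of_card_le hAj hle
      have : (eT ⟨A, hA⟩).1 = y := Subtype.ext (hw heq)
      exact (eT ⟨A, hA⟩).2 (this ▸ hyJ)
    obtain ⟨⟨A', hA'⟩, hA'y⟩ := eT.surjective ⟨y, hy⟩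
    refine ⟨A', hA', ?_⟩
    rw [hβA A' hA', hA'y]
  · intro A hA
    rw [hβA A hA]
    exact ⟨subset_rfl, (eT ⟨A, hA⟩).1.2, hWs⟩
  · intro A hA A' hA' hAA
    exact hρinj hA hA' (congrArg Prod.fst hAA :)

/-- **The registered residual implies the UQ² residual** (the UQ² residual class is the smaller one): lossless. -/
theorem stub_uq2FaceResidual_of_uqFaceResidual (hR : Stmt.stub_uqFaceResidual) : Stmt.stub_uq2FaceResidual := by
  obtain ⟨s, h₀, hs, hR⟩ := hR
  refine ⟨s, h₀, hs, fun h hh r u w hu hw hlu hlw hr hx hy => hR h hh r u w hu hw hlu hlw hr ?_ ?_⟩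
  · intro a W₀ 𝒜 ρ hD
    obtain ⟨β, σ, hD2⟩ := exists_uqf2Data_of_uqfData hw hD
    exact hx a W₀ 𝒜 ρ β σ hD2
  · intro c Z 𝒜 ρ hD
    obtain ⟨β, σ, hD2⟩ := exists_uqf2Data_of_uqfData hu hD
    exact hy c Z 𝒜 ρ β σ hD2

end

end Summit.ValiantsHypothesis.ValiantsHypothesis.Theorems.BarrierLever.AnchoredPeeling
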